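import Mathlib
import HarnessLib
import Summits.HubbardSuperconductivity.HubbardSuperconductivity.Theorems.KLProgrammeKLRegimeEngineTowerBlockIncrLevOriented

/-!
# Route `KLProgramme` — crux K3 ENGINE (stmt-HubbardSuperconductivity-20437 `KLRegimeEngineV17F2`), stub (b) v2, THE LEVELS PACKAGE (ℓ), located item
# «(ℓ)-READOUT-F» piece (RO-2), layer (a′): the ORIENTED levelled block-step door ON A PARTIAL-BLOCK INCREMENT `𝒱_j − 𝒱_{dk}`, `dk ≤ j`
# (cell gate-hubbard-kl, seat hubbard-kl-k3c2-p3 g14; twin of k3c3-p2's `doorSum_klTowerIncr_le_oriented` (…TowerBlockIncrLevOriented §2) with the slice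
#  `(Λ_{d(k+1)}, Λ_{dk}]` replaced by `(Λ_j, Λ_{dk}]`; at `j = d(k+1)` the partial increment IS `Δ_k`)

WHY.  Stub (b)'s conjunct `KernelNormsLevels … (K_n) j` reads the action `𝒱_j` at its own family for EVERY `j ≤ n`, not only at block boundaries; with
`dk ≤ j < d(k+1)`, `𝒱_j = 𝒱_{dk} + (𝒱_j − 𝒱_{dk})` and the second summand — ONE Gaussian step `effAction C^K_{(Λ_j, Λ_{dk}]} 𝒱_{dk} − 𝒱_{dk}` of a PARTIAL block —
needs the same oriented kit bound as `Δ_k`.  The two doors `blockStep_ordersGe2_wtOriented_le` / `blockStep_firstOrder_lev_le` are generic in the scale pair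
`(J₁, J₂) = (dk, j)`; this file is the instantiation, written WITHOUT new definitions (the partial increment is spelled
`klEffectiveAction L M β U μ K klE0 j − klTowerInput L M β U μ K d k`):

* §1 `partialIncr_eq_ordersGe2_add_firstOrder` (orders ≥ 2 plus first order of the partial step, `Z^K_{Λ_{dk}} ≠ 0`);
* §2 **`doorSum_partialIncr_le_oriented`** — the statement of `doorSum_klTowerIncr_le_oriented` verbatim with the slice `(Λ_j, Λ_{dk}]` (`hj : dk ≤ j`) in the
  Gram / row / column hypotheses and the partial increment in the conclusion; input `𝒱_{dk}` at `F̃_{dk−1}` (the law's input profile), output family any `J′ ≥ dk`.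
Compositions of landed theorems; nothing about the model is asserted beyond them; nothing asserts (ℓ), any stub, K3 or superconductivity.
References: BGM 2006 §2.7 (2.66), (2.70)–(2.71a), §2.8 (2.76)–(2.84), (2.88)–(2.90), (2.97)–(2.98), App. A3, App. A4 [cite: BenfattoGiulianiMastropietro2006].
-/

noncomputable section

namespace Summit.HubbardSuperconductivity.HubbardSuperconductivity.Theorems.EngineV8

set_option linter.dupNamespace false -- summit = problem name (single-conjunct summit), D-0017

open Classical
open Real Finset Literature.MathematicalPhysics.QuantumLattice Literature.Probability.LatticeModels GrassmannAlgebra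
open Literature.MathematicalPhysics.QuantumLattice.FermiRG Literature.MathematicalPhysics.QuantumLattice.FermiRG.BGM2006Routing
open Summit.HubbardSuperconductivity.HubbardSuperconductivity.Theorems.KLProgrammeLegKernels
open Summit.HubbardSuperconductivity.HubbardSuperconductivity.Theorems.KLRegimeSplit
open Summit.HubbardSuperconductivity.HubbardSuperconductivity.Theorems.KLRegimeWick
open Summit.HubbardSuperconductivity.HubbardSuperconductivity.Theorems.TwoPointAssembly
open Literature.Probability.LatticeModels.BattleFederbush
open scoped Nat

variable {L M : ℕ} [NeZero L] [NeZero M]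

/-! ## §1 The partial step: orders ≥ 2 plus first order -/

omit [NeZero M] in
/-- **Orders ≥ 2 plus first order of a partial block**: with `Γ = C^K_{(Λ_j, Λ_{dk}]}` and `Z^K_{Λ_{dk}} ≠ 0`,
`𝒱_j − 𝒱_{dk} = (effAction Γ 𝒱_{dk} − e^{Δ_Γ} 𝒱_{dk}) + (e^{Δ_Γ} 𝒱_{dk} − 𝒱_{dk})`. -/
theorem partialIncr_eq_ordersGe2_add_firstOrder (β U μ : ℝ) (K : TrigPolyC4v) (d k j : ℕ)
    (hZ : hubbardEffPartitionFnCT L M β U μ 0 K (klScale klE0 (d * k)) ≠ 0) :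
    klEffectiveAction L M β U μ K klE0 j - klTowerInput L M β U μ K d k =
      (effAction ℂ (hubbardCovSliceCT L M β μ 0 K (klScale klE0 j) (klScale klE0 (d * k))) (klTowerInput L M β U μ K d k) -
          gaussConv ℂ (hubbardCovSliceCT L M β μ 0 K (klScale klE0 j) (klScale klE0 (d * k))) (klTowerInput L M β U μ K d k)) +
        (gaussConv ℂ (hubbardCovSliceCT L M β μ 0 K (klScale klE0 j) (klScale klE0 (d * k))) (klTowerInput L M β U μ K d k) -
          klTowerInput L M β U μ K d k) := by
  unfold klTowerInput
  rw [klEffectiveAction_eq_effAction_slice β U μ K klE0 j (d * k) hZ]; abel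

/-! ## §2 The oriented block step on a partial increment, door form -/

/-- **THE ORIENTED LEVELLED BLOCK STEP ON THE PARTIAL INCREMENT `𝒱_j − 𝒱_{dk}`, DOOR FORM** (`1 ≤ d`, `1 ≤ k`, `dk ≤ j`, `dk ≤ J′`, `Z^K_{Λ_{dk}} ≠ 0`): the
statement of `doorSum_klTowerIncr_le_oriented` with the slice `(Λ_j, Λ_{dk}]` — UNWEIGHTED block constants (Gram `κ`, rows/cols `α` of `S(F̃)ᵀΓS(F̃)`, radius `ρ`,
overlap `(cr, cc)` of `E(F_{J′})·S(F̃)`, truncation `N₀ ≥ 2`), the abstract levelled majorant `Nl` with its (I3) rows, `Bm·θ^{lumps}`, the door guard; conclusion: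
the door-form sum of `‖kernel (map E(F_{J′})) (𝒱_j − 𝒱_{dk}) (2q+2) ·‖` is at most the oriented orders-≥2 right side plus the first-order binomial-prescribed
right side — the SAME right side as for `Δ_k` (it only reads the input `𝒱_{dk}` at `F̃_{dk−1}`). -/
theorem doorSum_partialIncr_le_oriented {β : ℝ} (hβ : 0 < β) (U μ : ℝ) (K : TrigPolyC4v) {d k j J' : ℕ} (hd : 1 ≤ d) (hk : 1 ≤ k)
    (hj : d * k ≤ j) (hJ' : d * k ≤ J') (hZ : hubbardEffPartitionFnCT L M β U μ 0 K (klScale klE0 (d * k)) ≠ 0)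
    {κ : ℝ} (hκ : 0 < κ)
    (hGB : IsGramBoundedR ((sectorSubMatrix L M β (bgmFatMultiplier L M klE0 β (nambuXiCT L μ K) (d * k - 1))).transpose *
      hubbardCovSliceCT L M β μ 0 K (klScale klE0 j) (klScale klE0 (d * k)) *
        sectorSubMatrix L M β (bgmFatMultiplier L M klE0 β (nambuXiCT L μ K) (d * k - 1))) κ)
    {α : ℝ} (hα : 0 < α)
    (hrow : ∀ X, ∑ Y, ‖((sectorSubMatrix L M β (bgmFatMultiplier L M klE0 β (nambuXiCT L μ K) (d * k - 1))).transpose *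
        hubbardCovSliceCT L M β μ 0 K (klScale klE0 j) (klScale klE0 (d * k)) *
          sectorSubMatrix L M β (bgmFatMultiplier L M klE0 β (nambuXiCT L μ K) (d * k - 1))) X Y‖ ≤ α)
    (hcol : ∀ Y, ∑ X, ‖((sectorSubMatrix L M β (bgmFatMultiplier L M klE0 β (nambuXiCT L μ K) (d * k - 1))).transpose *
        hubbardCovSliceCT L M β μ 0 K (klScale klE0 j) (klScale klE0 (d * k)) *
          sectorSubMatrix L M β (bgmFatMultiplier L M klE0 β (nambuXiCT L μ K) (d * k - 1))) X Y‖ ≤ α)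
    {ρ : ℝ} (hρ : 0 < ρ)
    {cr cc : ℝ} (hcc0 : 0 ≤ cc)
    (hrow' : ∀ X'', ∑ X', ‖(sectorAnalysisMatrix L M β (klAnisoFamily L M β μ K klE0 J') *
        sectorSubMatrix L M β (bgmFatMultiplier L M klE0 β (nambuXiCT L μ K) (d * k - 1))) X'' X'‖ ≤ cr)
    (hcol' : ∀ X', ∑ X'', ‖(sectorAnalysisMatrix L M β (klAnisoFamily L M β μ K klE0 J') *
        sectorSubMatrix L M β (bgmFatMultiplier L M klE0 β (nambuXiCT L μ K) (d * k - 1))) X'' X'‖ ≤ cc)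
    {N₀ : ℕ} (hN₀ : 2 ≤ N₀)
    (Nl : ℕ → ℕ → ℝ) (hNl0 : ∀ m' Lv, 0 ≤ Nl m' Lv) (hanti : ∀ m' Lv Lv', Lv ≤ Lv' → Nl m' Lv' ≤ Nl m' Lv)
    (hBN : ∀ m' Fc, imagTimeWeight β M * klTowerMeasLev L M β U μ K d k (2 * (m' + 1)) Fc ≤ Nl (m' + 1) (Fc + 1))
    (hB'N0 : ∀ m', imagTimeWeight β M * ((Fintype.card (SectorLeg (sectorCount (d * k - 1))) : ℝ) *
      klTowerMeasLev L M β U μ K d k (2 * (m' + 1)) 0) ≤ Nl (m' + 1) 0)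
    (Bm : ℕ → ℝ) (hBm0 : ∀ m', 0 ≤ Bm m') {θ : ℝ} (hθ0 : 0 ≤ θ) (hdom : ∀ m' Lv, 1 ≤ Lv → Nl m' Lv ≤ Bm m' * θ ^ lumps Lv)
    (hθV : Real.exp 1 * α * normV (SpaceTimeIdx L M × SectorLeg (sectorCount (d * k - 1))) κ ρ
      (fun m' => imagTimeWeight β M * klTowerMeasLev L M β U μ K d k (2 * m') 0) / κ ^ 2 < 1)
    {q : ℕ} (p : Fin (2 * q + 1 + 1)) (J : Finset (Fin (2 * q + 1 + 1))) (hp : p ∉ J)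
    (τ'' : Fin (2 * q + 1 + 1) → SectorLeg (sectorCount J')) (w'' : SpaceTimeIdx L M × SectorLeg (sectorCount J')) :
    ∑ X'' ∈ univ.filter (fun X'' : Fin (2 * q + 1 + 1) → SpaceTimeIdx L M × SectorLeg (sectorCount J') =>
        X'' p = w'' ∧ ∀ j ∈ J, (X'' j).2 = τ'' j),
        ‖kernel ℂ (ExteriorAlgebra.map (Matrix.toLin' (sectorAnalysisMatrix L M β (klAnisoFamily L M β μ K klE0 J')))
          (klEffectiveAction L M β U μ K klE0 j - klTowerInput L M β U μ K d k)) (2 * q + 1 + 1) X''‖ ≤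
      cr * cc ^ (2 * q + 1) * ((∏ j ∈ J, (((univ.filter fun ℓ' : SectorLeg (sectorCount (d * k - 1)) =>
          (∃ q' : FreqMomentum L M, klAnisoFamily L M β μ K klE0 J' (τ'' j).1.1 q' ≠ 0 ∧
            bgmFatMultiplier L M klE0 β (nambuXiCT L μ K) (d * k - 1) ℓ'.1.1 q' ≠ 0) ∧
          ℓ'.1.2 = (τ'' j).1.2 ∧ ℓ'.2 = (τ'' j).2).card : ℕ) : ℝ)) *
        (∑ n ∈ Ico 2 N₀, (κ⁻¹ ^ (2 * q + 1 + 1) * κ⁻¹ ^ (2 * (n - 1)) * ((((36 : ℕ) : ℝ) * α) ^ (n - 1) * Real.exp n)) *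
            ∑ δ ∈ (Fintype.piFinset fun _ : Fin n => range (Fintype.card (SpaceTimeIdx L M × SectorLeg (sectorCount (d * k - 1))) / 2 + 1)) with
                2 * q + 1 + 1 + 2 * (n - 1) ≤ ∑ a, 2 * δ a,
              ∑ pf : J → Fin n, ((∏ j, ((2 * δ (pf j) : ℕ) : ℝ)) / ((∑ a, 2 * δ a : ℕ) : ℝ) ^ J.card) *
                ((Real.exp 3 * κ) ^ (∑ a, 2 * δ a) * ((∏ a, Bm (δ a)) * θ ^ lumps (1 + J.card))) +
          ρ⁻¹ ^ (2 * q + 1 + 1) * (Real.exp 1 * normV (SpaceTimeIdx L M × SectorLeg (sectorCount (d * k - 1))) κ ρ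
              (fun m' => imagTimeWeight β M * klTowerMeasLev L M β U μ K d k (2 * m') 0)) *
            (Real.exp 1 * α * normV (SpaceTimeIdx L M × SectorLeg (sectorCount (d * k - 1))) κ ρ
                (fun m' => imagTimeWeight β M * klTowerMeasLev L M β U μ K d k (2 * m') 0) / κ ^ 2) ^ (N₀ - 1) /
            (1 - Real.exp 1 * α * normV (SpaceTimeIdx L M × SectorLeg (sectorCount (d * k - 1))) κ ρ
                (fun m' => imagTimeWeight β M * klTowerMeasLev L M β U μ K d k (2 * m') 0) / κ ^ 2))) +
      cr * cc ^ (2 * q + 1) *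
        ∑ m' ∈ range (Fintype.card (SpaceTimeIdx L M × SectorLeg (sectorCount (d * k - 1))) / 2 + 1), (if q + 1 < m' then
          ((((2 * (q + 1)).factorial : ℝ))⁻¹ * ((∏ j ∈ univ.filter (fun j : Fin (2 * (q + 1)) => j ∉ J), (2 * m' - (j : ℕ)) : ℕ) : ℝ)) *
            ((2 * m' : ℕ) : ℝ) ^ J.card * κ ^ (2 * m' - 2 * (q + 1)) *
              ((27 : ℝ) ^ J.card * (imagTimeWeight β M * klTowerMeasLev L M β U μ K d k (2 * m') J.card)) else 0) := by
  have hβ' : β ≠ 0 := hβ.ne'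
  have hJ₁ : 1 ≤ d * k := le_trans hd (Nat.le_mul_of_pos_right d hk)
  have hJ : d * k ≤ j := hj
  have hG : klTowerInput L M β U μ K d k ∈ evenPart ℂ (HubbardFieldIdx L M) := klEffectiveAction_mem_evenPart hβ' U μ K klE0 (d * k)
  have hG0 : constPart ℂ (klTowerInput L M β U μ K d k) = 0 := constPart_klEffectiveAction_eq_zero β U μ K klE0 (d * k) hZ
  -- the input families: measured levelled arrays (full pin) and the position-only family
  set B : ℕ → ℕ → ℝ := fun m c => klTowerMeasLev L M β U μ K d k (2 * m) c with hB
  set B' : ℕ → ℕ → ℝ := fun m Fc => if Fc = 0 then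
      (Fintype.card (SectorLeg (sectorCount (d * k - 1))) : ℝ) * klTowerMeasLev L M β U μ K d k (2 * m) 0
    else klTowerMeasLev L M β U μ K d k (2 * m) (Fc - 1) with hB'
  have hB0 : ∀ m c, 0 ≤ B m c := fun m c => klTowerMeasLev_nonneg hβ.le U μ K d k _ c
  have hBin : ∀ (m' Fc : ℕ) (E : Finset (Fin (2 * m' + 1 + 1))) (τ' : Fin (2 * m' + 1 + 1) → SectorLeg (sectorCount (d * k - 1)))
      (q' : Fin (2 * m' + 1 + 1)), q' ∈ E → E.card = Fc + 1 → ∀ y : SpaceTimeIdx L M,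
        imagTimeWeight β M ^ (2 * m' + 1) *
          ∑ σ ∈ univ.filter (fun σ : Fin (2 * m' + 1 + 1) → SectorLeg (sectorCount (d * k - 1)) => ∀ e ∈ E, σ e = τ' e),
            ∑ x ∈ univ.filter (fun x : Fin (2 * m' + 1 + 1) → SpaceTimeIdx L M => x q' = y),
              ‖sectorisedKernel L M β (klAnisoFamily L M β μ K klE0 (d * k - 1)) (klTowerInput L M β U μ K d k) (2 * m' + 1 + 1) σ x‖ ≤
          B (m' + 1) Fc :=
    fun m' Fc E τ' q' hq hE y => doorInput_klTowerInput_le_klTowerMeasLev hβ.le U μ K d k m' Fc E τ' q' hq hE y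
  -- the weighted (weight `1`) forms of the two input rows
  have hBw : ∀ (m' Fc : ℕ) (E : Finset (Fin (2 * m' + 1 + 1))) (τ' : Fin (2 * m' + 1 + 1) → SectorLeg (sectorCount (d * k - 1)))
      (q' : Fin (2 * m' + 1 + 1)), q' ∈ E → E.card = Fc + 1 → ∀ y : SpaceTimeIdx L M,
        imagTimeWeight β M ^ (2 * m' + 1) *
          ∑ σ ∈ univ.filter (fun σ : Fin (2 * m' + 1 + 1) → SectorLeg (sectorCount (d * k - 1)) => ∀ e ∈ E, σ e = τ' e),
            ∑ x ∈ univ.filter (fun x : Fin (2 * m' + 1 + 1) → SpaceTimeIdx L M => x q' = y),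
              (fun _ : Finset Unit => (1 : ℝ)) ((univ.image fun i => (x i, σ i)).image (fun _ => ())) *
              ‖sectorisedKernel L M β (klAnisoFamily L M β μ K klE0 (d * k - 1)) (klTowerInput L M β U μ K d k) (2 * m' + 1 + 1) σ x‖ ≤
          B (m' + 1) Fc := fun m' Fc E τ' q' hq hE y => by
    simpa only [one_mul] using hBin m' Fc E τ' q' hq hE y
  have hB'w : ∀ (m' Fc : ℕ) (E : Finset (Fin (2 * m' + 1 + 1))) (τ' : Fin (2 * m' + 1 + 1) → SectorLeg (sectorCount (d * k - 1)))
      (t : Fin (2 * m' + 1 + 1)), t ∉ E → E.card = Fc → ∀ yσ : SectorLeg (sectorCount (d * k - 1)) → SpaceTimeIdx L M,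
        imagTimeWeight β M ^ (2 * m' + 1) *
          ∑ σ ∈ univ.filter (fun σ : Fin (2 * m' + 1 + 1) → SectorLeg (sectorCount (d * k - 1)) => ∀ e ∈ E, σ e = τ' e),
            ∑ x ∈ univ.filter (fun x : Fin (2 * m' + 1 + 1) → SpaceTimeIdx L M => x t = yσ (σ t)),
              (fun _ : Finset Unit => (1 : ℝ)) ((univ.image fun i => (x i, σ i)).image (fun _ => ())) *
              ‖sectorisedKernel L M β (klAnisoFamily L M β μ K klE0 (d * k - 1)) (klTowerInput L M β U μ K d k) (2 * m' + 1 + 1) σ x‖ ≤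
          B' (m' + 1) Fc := fun m' Fc E τ' t _ hE yσ => by
    simpa only [one_mul] using swInput_klTowerInput_le_towerBsw hβ U μ K d k m' Fc E τ' t hE yσ
  -- (I3) rows for the position-only family from `hBN` and the level-`0` row
  have hB'N : ∀ m' Fc, imagTimeWeight β M * B' (m' + 1) Fc ≤ Nl (m' + 1) Fc := by
    intro m' Fc
    rcases Fc with _ | F₀
    · rw [hB', towerBsw_zero]; exact hB'N0 m'
    · rw [hB', towerBsw_succ]; exact hBN m' F₀
  have hBN' : ∀ m' Fc, imagTimeWeight β M * B (m' + 1) Fc ≤ Nl (m' + 1) (Fc + 1) := fun m' Fc => hBN m' Fc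
  -- (I1): the talking relation with `c = 36`
  have h36 : (1 : ℕ) ≤ 36 := by norm_num
  -- the weight-`1` rows/cols
  have hroww : ∀ X, ∑ Y, ‖((sectorSubMatrix L M β (bgmFatMultiplier L M klE0 β (nambuXiCT L μ K) (d * k - 1))).transpose *
        hubbardCovSliceCT L M β μ 0 K (klScale klE0 j) (klScale klE0 (d * k)) *
          sectorSubMatrix L M β (bgmFatMultiplier L M klE0 β (nambuXiCT L μ K) (d * k - 1))) X Y‖ *
        (fun _ : Finset Unit => (1 : ℝ)) {(fun _ : SpaceTimeIdx L M × SectorLeg (sectorCount (d * k - 1)) => ()) X,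
          (fun _ : SpaceTimeIdx L M × SectorLeg (sectorCount (d * k - 1)) => ()) Y} ≤ α := fun X => by
    simpa only [mul_one] using hrow X
  have hcolw : ∀ Y, ∑ X, ‖((sectorSubMatrix L M β (bgmFatMultiplier L M klE0 β (nambuXiCT L μ K) (d * k - 1))).transpose *
        hubbardCovSliceCT L M β μ 0 K (klScale klE0 j) (klScale klE0 (d * k)) *
          sectorSubMatrix L M β (bgmFatMultiplier L M klE0 β (nambuXiCT L μ K) (d * k - 1))) X Y‖ *
        (fun _ : Finset Unit => (1 : ℝ)) {(fun _ : SpaceTimeIdx L M × SectorLeg (sectorCount (d * k - 1)) => ()) X,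
          (fun _ : SpaceTimeIdx L M × SectorLeg (sectorCount (d * k - 1)) => ()) Y} ≤ α := fun Y => by
    simpa only [mul_one] using hcol Y
  have hrow'w : ∀ X'', ∑ X', ‖(sectorAnalysisMatrix L M β (klAnisoFamily L M β μ K klE0 J') *
        sectorSubMatrix L M β (bgmFatMultiplier L M klE0 β (nambuXiCT L μ K) (d * k - 1))) X'' X'‖ *
        (fun _ : Finset Unit => (1 : ℝ)) {(fun _ : SpaceTimeIdx L M × SectorLeg (sectorCount J') => ()) X'',
          (fun _ : SpaceTimeIdx L M × SectorLeg (sectorCount (d * k - 1)) => ()) X'} ≤ cr := fun X'' => by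
    simpa only [mul_one] using hrow' X''
  have hcol'w : ∀ X', ∑ X'', ‖(sectorAnalysisMatrix L M β (klAnisoFamily L M β μ K klE0 J') *
        sectorSubMatrix L M β (bgmFatMultiplier L M klE0 β (nambuXiCT L μ K) (d * k - 1))) X'' X'‖ *
        (fun _ : Finset Unit => (1 : ℝ)) {(fun _ : SpaceTimeIdx L M × SectorLeg (sectorCount J') => ()) X'',
          (fun _ : SpaceTimeIdx L M × SectorLeg (sectorCount (d * k - 1)) => ()) X'} ≤ cc := fun X' => by
    simpa only [mul_one] using hcol' X'
  -- a default sector of the input alphabet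
  obtain ⟨σdef⟩ : Nonempty (SectorLeg (sectorCount (d * k - 1))) := ⟨((⟨0, sectorCount_pos _⟩, 0), 0)⟩
  -- the two doors at this `(p, J, τ″, w″)`
  have h2 := blockStep_ordersGe2_wtOriented_le (L := L) (M := M) (IsTreeWeight.const_one (Λ := Unit)) hβ μ K hJ₁ hJ hJ'
    (fun _ : SpaceTimeIdx L M × SectorLeg (sectorCount (d * k - 1)) => ())
    (fun _ : SpaceTimeIdx L M × SectorLeg (sectorCount J') => ())
    (klTowerInput L M β U μ K d k) hG hG0 σdef
    (fun σ σ' : SectorLeg (sectorCount (d * k - 1)) => ∃ q' : FreqMomentum L M,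
      bgmFatMultiplier L M klE0 β (nambuXiCT L μ K) (d * k - 1) σ.1.1 q' *
        bgmFatMultiplier L M klE0 β (nambuXiCT L μ K) (d * k - 1) σ'.1.1 q' ≠ 0)
    h36 (fun σ' => card_filter_overlap_bgmFat_sectorLeg_le (L := L) (M := M) (K := K) (μ := μ) (e₀ := klE0) (β := β) (d * k - 1) σ')
    (fun X Y hXY => hCov_bgmFat_hubbardCovSliceCT hβ' μ klE0 K _ _ (d * k - 1) X Y hXY)
    hκ hGB B B' hB0 hBw hB'w Nl hNl0 hanti hBN' hB'N Bm hBm0 hθ0 hdom hα hroww hcolw hρ hθV hcc0 hrow'w hcol'w hN₀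
    (m := 2 * q + 1) p J hp τ'' w''
  simp only [one_mul] at h2
  have h1 := blockStep_firstOrder_lev_le (L := L) (M := M) hβ μ K hJ₁ hJ hJ' (klTowerInput L M β U μ K d k) hG hκ.le hGB B hB0 hBin hcc0
    hrow' hcol' (q := q) p J hp τ'' w''
  -- split `Δ_k` inside the door-form sum
  rw [partialIncr_eq_ordersGe2_add_firstOrder β U μ K d k j hZ, map_add]
  refine le_trans (sum_le_sum fun X _ => ?_) (le_trans (le_of_eq sum_add_distrib) (add_le_add h2 h1))
  rw [kernel_add]
  exact norm_add_le _ _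

end Summit.HubbardSuperconductivity.HubbardSuperconductivity.Theorems.EngineV8

end
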